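import Summits.Ventures.CertifiedArithmetic.LowPrec.AccumulateLangeRump
import Summits.Ventures.CertifiedArithmetic.LowPrec.AccumulateTwoLevel

/-!
# Blocked (two-level) accumulation with the Lange–Rump constants

HONEST FRAMING (venture CertifiedArithmetic / cell `pub-lowprec`): certified error envelopes and
provably optimal rounding/accumulation schemes for low-precision formats under stated cost models;
every table by two implementations; no hardware or vendor claims.

`AccumulateTwoLevel.lean` composes the two Jeannerod–Rump constants `u' = u/(1+u)` for blocked
(split-K) orders with two accumulator formats. Here the same composition with the SHARP Lange–Rump
constants `θ_k(u) = k u/(1 + k u)` of `AccumulateLangeRump.lean`, under the restriction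
`K - 1 ≤ ½u_α⁻¹`, `B - 1 ≤ ½u_β⁻¹` (largest block `K`, `B` blocks):
`|ŝ - s| ≤ [θ_{K-1}(u_α) + θ_{B-1}(u_β)(1 + θ_{K-1}(u_α))]·Σ|xᵢ|` for ANY inner trees in `α`
and ANY outer tree in `β` (`abs_twoLevel_sub_exact_le_langeRump`), and in one format
`|ŝ - s| ≤ (K + B - 2)·u·Σ|xᵢ|` (`abs_twoLevel_sub_exact_le_langeRump_one`) — the statement of
[LangeRump2018, Prop 14] (Lange–Rump, Math. Comp. 88 (2019), blocked summation with fixed block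
size, `max(m, n) ≤ 1 + ½u⁻¹`), there for recursive blocks, here for arbitrary evaluation trees at
both levels; the closing algebra `p/(1+p)(1 + q/(1+q)) + q/(1+q) ≤ p + q` is
`langeRump_blocked_const_le`. This is the GEMM note's Cor. (c) ("blocked(b)") with proved
constants.
-/

namespace Literature.ComputerArithmetic.FloatingPoint

namespace MiniFloat

open Literature.ComputerArithmetic.JeannerodRump2018
open Literature.ComputerArithmetic.JeannerodRump2018.SumTree

variable {α : Format}

/-! ### Blocked (two-level) accumulation with the Lange–Rump constants [LangeRump2018, Prop 14] -/

/-- `x ↦ x/(1+x)` is monotone on `x ≥ 0` (applied to `k·u`). [folklore] -/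
theorem langeRump_const_mono {a b u : ℚ} (ha : 0 ≤ a) (hab : a ≤ b) (hu : 0 ≤ u) :
    a * u / (1 + a * u) ≤ b * u / (1 + b * u) := by
  have hau : 0 ≤ a * u := mul_nonneg ha hu
  have hbu : a * u ≤ b * u := mul_le_mul_of_nonneg_right hab hu
  rw [div_le_div_iff₀ (by linarith) (by linarith)]
  nlinarith

/-- Under the Lange–Rump restriction an in-range tree's value is at most `(1 + θ_{n-1})·Σ|xᵢ|`.
[cite: LangeRump2018, Prop 1] -/
theorem abs_eval_le_langeRump (hα : 2 ≤ α.emaxCode) (t : SumTree) (ht : TreeInRange α t)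
    (hk : 2 * ((t.leaves.length : ℚ) - 1) * α.unitRoundoff ≤ 1) :
    |SumTree.eval (flα α) t| ≤ (1 + ((t.leaves.length : ℚ) - 1) * α.unitRoundoff
      / (1 + ((t.leaves.length : ℚ) - 1) * α.unitRoundoff)) * absSum t := by
  have h1 := abs_eval_sub_exact_le_langeRump hα t ht hk
  have h2 := abs_exact_le_absSum t
  have : SumTree.eval (flα α) t = (SumTree.eval (flα α) t - SumTree.exact t) + SumTree.exact t := by
    ring
  rw [this]
  refine le_trans (abs_add_le _ _) ?_
  linarith

/-- BLOCKED ACCUMULATION WITH THE LANGE–RUMP CONSTANTS (two formats, any inner and outer trees):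
inner blocks `tⱼ` evaluated in `α` (leaves in `F_α`, nodes in range, at most `K` leaves each,
`K - 1 ≤ ½u_α⁻¹`), their computed values (assumed values of `β`) combined by an outer tree `T` in
`β` (nodes in range, `B` blocks, `B - 1 ≤ ½u_β⁻¹`). Then with `θ_k(u) = k u/(1 + k u)`:
`|ŝ - Σⱼ sⱼ| ≤ [θ_{K-1}(u_α) + θ_{B-1}(u_β)·(1 + θ_{K-1}(u_α))] · Σⱼ Σ|xᵢ|`. The one-format case
is [LangeRump2018, Prop 14] (there: recursive blocks), whose statement bounds this by
`(K + B - 2)·u` (`langeRump_blocked_const_le`). [cite: LangeRump2018, Prop 14] -/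
theorem abs_twoLevel_sub_exact_le_langeRump {β : Format} (hα : 2 ≤ α.emaxCode)
    (hβ : 2 ≤ β.emaxCode) (ts : List SumTree) (T : SumTree) (K : ℕ)
    (hT : T.leaves = ts.map (SumTree.eval (flα α)))
    (hinner : ∀ t ∈ ts, TreeInRange α t) (hK : ∀ t ∈ ts, t.leaves.length ≤ K)
    (hKu : 2 * ((K : ℚ) - 1) * α.unitRoundoff ≤ 1)
    (houter : TreeInRange β T) (hBu : 2 * ((ts.length : ℚ) - 1) * β.unitRoundoff ≤ 1) :
    |SumTree.eval (flα β) T - (ts.map SumTree.exact).sum|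
      ≤ (((K : ℚ) - 1) * α.unitRoundoff / (1 + ((K : ℚ) - 1) * α.unitRoundoff)
          + ((ts.length : ℚ) - 1) * β.unitRoundoff / (1 + ((ts.length : ℚ) - 1) * β.unitRoundoff)
            * (1 + ((K : ℚ) - 1) * α.unitRoundoff / (1 + ((K : ℚ) - 1) * α.unitRoundoff)))
        * (ts.map absSum).sum := by
  have hua := α.unitRoundoff_pos
  have hub := β.unitRoundoff_pos
  set θa := ((K : ℚ) - 1) * α.unitRoundoff / (1 + ((K : ℚ) - 1) * α.unitRoundoff) with hθa
  set θb := ((ts.length : ℚ) - 1) * β.unitRoundoff / (1 + ((ts.length : ℚ) - 1) * β.unitRoundoff)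
    with hθb
  set L := (ts.map absSum).sum with hL
  have hL0 : 0 ≤ L := sum_map_nonneg ts absSum fun t _ => absSum_nonneg t
  -- K ≥ 1 as soon as there is a block; θa, θb ≥ 0 then
  have hK1 : ∀ t ∈ ts, (1 : ℚ) ≤ K := fun t ht => by
    have := one_le_length_leaves t; have := hK t ht; exact_mod_cast (by omega : 1 ≤ K)
  -- (a) inner errors: Σⱼ |ŝⱼ - sⱼ| ≤ θa·L (monotonicity of θ in the leaf count)
  have hin : (ts.map fun t => |SumTree.eval (flα α) t - SumTree.exact t|).sum ≤ θa * L := by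
    rw [hL, ← sum_map_const_mul]
    refine sum_map_le_sum_map ts _ _ fun t ht => ?_
    have hn1 : (1 : ℚ) ≤ t.leaves.length := by exact_mod_cast one_le_length_leaves t
    have hnK : (t.leaves.length : ℚ) ≤ K := by exact_mod_cast hK t ht
    have hkt : 2 * ((t.leaves.length : ℚ) - 1) * α.unitRoundoff ≤ 1 := by nlinarith
    have h1 := abs_eval_sub_exact_le_langeRump hα t (hinner t ht) hkt
    refine le_trans h1 (mul_le_mul_of_nonneg_right ?_ (absSum_nonneg t))
    exact langeRump_const_mono (by linarith) (by linarith) hua.le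
  -- (b) the outer leaf sum: Σⱼ |ŝⱼ| ≤ (1 + θa)·L
  have hleaf : absSum T ≤ (1 + θa) * L := by
    have e : absSum T = (ts.map fun t => |SumTree.eval (flα α) t|).sum := by
      rw [absSum, hT, List.map_map]; rfl
    rw [e, hL, ← sum_map_const_mul]
    refine sum_map_le_sum_map ts _ _ fun t ht => ?_
    have hn1 : (1 : ℚ) ≤ t.leaves.length := by exact_mod_cast one_le_length_leaves t
    have hnK : (t.leaves.length : ℚ) ≤ K := by exact_mod_cast hK t ht
    have hkt : 2 * ((t.leaves.length : ℚ) - 1) * α.unitRoundoff ≤ 1 := by nlinarith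
    have h1 := abs_eval_le_langeRump hα t (hinner t ht) hkt
    refine le_trans h1 (mul_le_mul_of_nonneg_right ?_ (absSum_nonneg t))
    have := langeRump_const_mono (u := α.unitRoundoff) (by linarith : (0:ℚ) ≤ t.leaves.length - 1)
      (by linarith : (t.leaves.length : ℚ) - 1 ≤ K - 1) hua.le
    linarith
  -- (c) outer error ≤ θb·absSum T
  have hBlen : (T.leaves.length : ℚ) = ts.length := by rw [hT, List.length_map]
  have hout := abs_eval_sub_exact_le_langeRump hβ T houter (by rw [hBlen]; exact hBu)
  rw [hBlen] at hout
  -- (d) exact T = Σⱼ ŝⱼ and |Σⱼ ŝⱼ - Σⱼ sⱼ| ≤ Σⱼ |ŝⱼ - sⱼ|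
  have hexT : SumTree.exact T = (ts.map (SumTree.eval (flα α))).sum := by
    rw [exact_eq_sum_leaves, hT]
  have hdiff := abs_sum_map_sub_le ts (SumTree.eval (flα α)) SumTree.exact
  have key : |SumTree.eval (flα β) T - (ts.map SumTree.exact).sum|
      ≤ |SumTree.eval (flα β) T - SumTree.exact T|
        + |(ts.map (SumTree.eval (flα α))).sum - (ts.map SumTree.exact).sum| := by
    rw [← hexT]
    calc |SumTree.eval (flα β) T - (ts.map SumTree.exact).sum|
        = |(SumTree.eval (flα β) T - SumTree.exact T)
            + (SumTree.exact T - (ts.map SumTree.exact).sum)| := by ring_nf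
      _ ≤ _ := abs_add_le _ _
  have hB1 : (0 : ℚ) ≤ (ts.length : ℚ) - 1 ∨ ts = [] := by
    cases ts with
    | nil => exact Or.inr rfl
    | cons a l => left; simp
  rcases hB1 with hB1 | hnil
  · have hθb0 : 0 ≤ θb := by rw [hθb]; exact div_nonneg (by nlinarith) (by nlinarith)
    have hout' : |SumTree.eval (flα β) T - SumTree.exact T| ≤ θb * ((1 + θa) * L) :=
      le_trans hout (mul_le_mul_of_nonneg_left hleaf hθb0)
    calc |SumTree.eval (flα β) T - (ts.map SumTree.exact).sum|
        ≤ θb * ((1 + θa) * L) + θa * L := by linarith [le_trans hdiff hin]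
      _ = (θa + θb * (1 + θa)) * L := by ring
  · subst hnil
    exfalso
    have h1 := one_le_length_leaves T
    rw [hT] at h1
    simp at h1

/-- The algebra of [LangeRump2018, Prop 14]: `p/(1+p)·(1 + q/(1+q)) + q/(1+q) ≤ p + q` for
`p, q ≥ 0` — so in one format the blocked bound reads `≤ (K + B - 2)·u·Σ|xᵢ|`.
[cite: LangeRump2018, Prop 14] -/
theorem langeRump_blocked_const_le {p q : ℚ} (hp : 0 ≤ p) (hq : 0 ≤ q) :
    q / (1 + q) + p / (1 + p) * (1 + q / (1 + q)) ≤ p + q := by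
  have hp1 : (0 : ℚ) < 1 + p := by linarith
  have hq1 : (0 : ℚ) < 1 + q := by linarith
  have key : p + q - (q / (1 + q) + p / (1 + p) * (1 + q / (1 + q)))
      = (p ^ 2 + q ^ 2 - p * q + (p + q) * (p * q)) / ((1 + p) * (1 + q)) := by
    field_simp
    ring
  have hnum : 0 ≤ p ^ 2 + q ^ 2 - p * q + (p + q) * (p * q) := by
    nlinarith [sq_nonneg (p - q), mul_nonneg hp hq, mul_nonneg (add_nonneg hp hq) (mul_nonneg hp hq)]
  have : 0 ≤ (p ^ 2 + q ^ 2 - p * q + (p + q) * (p * q)) / ((1 + p) * (1 + q)) :=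
    div_nonneg hnum (mul_pos hp1 hq1).le
  linarith

/-- ONE FORMAT (the setting of [LangeRump2018, Prop 14], any inner/outer trees): blocks of at most
`K` leaves, `B` blocks, `max(K, B) - 1 ≤ ½u⁻¹` ⟹ `|ŝ - s| ≤ (K + B - 2)·u·Σ|xᵢ|`.
[cite: LangeRump2018, Prop 14] -/
theorem abs_twoLevel_sub_exact_le_langeRump_one (hα : 2 ≤ α.emaxCode)
    (ts : List SumTree) (T : SumTree) (K : ℕ)
    (hT : T.leaves = ts.map (SumTree.eval (flα α)))
    (hinner : ∀ t ∈ ts, TreeInRange α t) (hK : ∀ t ∈ ts, t.leaves.length ≤ K)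
    (hKu : 2 * ((K : ℚ) - 1) * α.unitRoundoff ≤ 1)
    (houter : TreeInRange α T) (hBu : 2 * ((ts.length : ℚ) - 1) * α.unitRoundoff ≤ 1)
    (hK1 : 1 ≤ K) (hB1 : 1 ≤ ts.length) :
    |SumTree.eval (flα α) T - (ts.map SumTree.exact).sum|
      ≤ (((K : ℚ) - 1) + ((ts.length : ℚ) - 1)) * α.unitRoundoff * (ts.map absSum).sum := by
  have hu := α.unitRoundoff_pos
  have h := abs_twoLevel_sub_exact_le_langeRump hα hα ts T K hT hinner hK hKu houter hBu
  refine le_trans h (mul_le_mul_of_nonneg_right ?_ (sum_map_nonneg ts absSum fun t _ => absSum_nonneg t))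
  have hK1' : (1 : ℚ) ≤ K := by exact_mod_cast hK1
  have hB1' : (1 : ℚ) ≤ ts.length := by exact_mod_cast hB1
  have := langeRump_blocked_const_le (p := ((ts.length : ℚ) - 1) * α.unitRoundoff)
    (q := ((K : ℚ) - 1) * α.unitRoundoff) (by nlinarith) (by nlinarith)
  linarith

end MiniFloat

end Literature.ComputerArithmetic.FloatingPoint
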